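import Literature.NumberTheory.EllipticCurves.SelmerTorsionRestriction
import Literature.NumberTheory.EllipticCurves.SelmerGaloisAction
import HarnessLib

/-!
# The strict local kernels `ker (H¹(K, E[n]) → H¹(K_v, E[n]))` along a tower and under base change

`Proofs` file (theorems only: no definition, no named fact, no instance) in topic
`NumberTheory/EllipticCurves`, the `E[n]`-coefficient twin of the `E`-coefficient tower lemmas of
`ShaRestriction` (`localRestrictionKer_le_of_tower`, `mem_localRestrictionKer_iff_resBaseChange_mem`,
`resBaseChange_mem_sha`) for the STRICT local kernel
`WeierstrassCurve.torsionLocalKer W E n = ker (H¹(K, E[n]) → H¹(E, E(K̄_E)[n]))` of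
`SelmerGaloisAction` (McCallum's "`c_λ = 0` in `H¹(K_λ, E[p])`", Gross 1991 Prop. 8.2) and the
finite-level restriction `resTorsion W L n : H¹(K, E[n]) → H¹(L, E_L[n])` of
`SelmerTorsionRestriction`:

* `torsionLocalKer_eq_resKer_of_emb` — **independence of the embedding**: the kernel of
  `H¹(K, E[n]) → H¹(E, E(K̄_E)[n])` computed along ANY `K`-embedding `ι : K̄ → K̄_E` is
  `torsionLocalKer W E n` (two embeddings differ by `τ ∈ Γ_K`, `exists_algHom_eq_comp`, and inner
  automorphisms act trivially on `H¹(Γ_K, ·)`, `resKer_conj_comp`) — the strict twin of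
  `WeierstrassCurve.localRestrictionKerOfEmb_eq_holds` / `selmerLocalKer_eq_of_algHom_holds`;
* `torsionLocalKer_le_of_tower` — **strict local kernels grow along a tower** `K → E → E'` of
  `K`-fields: `torsionLocalKer W E n ≤ torsionLocalKer W E' n` (the restriction to `Γ_{E'}` factors
  through `Γ_E`, `resGalOfEmb_comp_tower`);
* `mem_torsionLocalKer_iff_resTorsion_mem` — **strict local conditions correspond under
  restriction to `L`**: for an `L`-field `E'`, `ξ ∈ H¹(K, E[n])` dies in `H¹(E', E(K̄_{E'})[n])`
  iff `res ξ ∈ H¹(L, E_L[n])` dies in `H¹(E', E_L(L̄_{E'})[n])` (the coefficient identification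
  `E(K̄_{E'})[n] = E_L(L̄_{E'})[n]`, `pointsCongr`, through `mem_resKer_iff_h1Equiv_mem`);
* `resTorsion_mem_torsionLocalKer_of_under` — for number fields `K ⊆ L`, a finite place `w` of
  `L` over `v = w ∩ 𝓞 K` and the completion tower `K_v → L_w` (`adicCompletionMap`):
  **`ξ ∈ torsionLocalKer W K_v n ⟹ resTorsion W L n ξ ∈ torsionLocalKer (W⁄L) L_w n`** — the
  plumbing binder (tower) of the over-`ℚ` `2`-descent of Kolyvagin's method at `p = 2`
  (`Summits/…/Theorems/CMKolyvaginAtInertTwoRationalDescentAtTwoDual.lean`, binder `htower`).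

Everything here is proved; nothing is assumed.

## References

* J.-P. Serre, *Galois Cohomology* (1997), I.§2.4 (compatible pairs; Prop. 3), II.§1.1 (the maps
  `H^q(G_K, A) → H^q(G_{K'}, A)` do not depend on the choice of the embedding).
  [SerreGaloisCohomology1997]
* J.-P. Serre, *Local Fields* (1979), VII.§5 Prop. 3 (inner automorphisms act trivially).
  [SerreLocalFields1979]
* W. G. McCallum, *Kolyvagin's work on Shafarevich–Tate groups* (1991), §3 (3) ("`c_λ = 0`").
  [McCallumLMS1991]
* J. S. Milne, *Arithmetic Duality Theorems*, 2nd ed. (2006), I.§6. [MilneADT2006]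
-/

noncomputable section

open scoped Classical

universe u

namespace Literature.NumberTheory.EllipticCurves

open GaloisRepresentations WeierstrassCurve

/-! ## Independence of the embedding -/

section Emb

variable {K : Type u} [Field K] (W : WeierstrassCurve K) {E : Type u} [Field E] [Algebra K E]

/-- **The strict local kernel does not depend on the embedding.** Let `ι : K̄ → K̄_E` be any
`K`-embedding and `ψ : E[n] → E(K̄_E)[n]` the map it induces on `n`-torsion points (characterised
by its values, `hψ`), compatible with the restriction `res_ι : Γ_E → Γ_K`. Then the kernel of
`H¹(K, E[n]) → H¹(E, E(K̄_E)[n])` along the pair `(res_ι, ψ)` is `torsionLocalKer W E n` (the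
kernel for the chosen embedding `closureEmb E`): `ι = ι₀ ∘ τ` for some `τ ∈ Γ_K`
(`exists_algHom_eq_comp`), which conjugates the compatible pair (`resGalOfEmb_comp`,
`pointsMapOfEmb_comp`), and inner automorphisms act trivially on `H¹(Γ_K, E[n])`
(`resKer_conj_comp`). [cite: SerreGaloisCohomology1997, II.§1.1 and I.§2.4 Prop. 3]
[cite: SerreLocalFields1979, VII.§5 Prop. 3] -/
theorem torsionLocalKer_eq_resKer_of_emb (ι : AlgebraicClosure K →ₐ[K] AlgebraicClosure E) (n : ℤ)
    (ψ : geomTorsion W n →+ AddSubgroup.torsionBy (localPoints W E) n)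
    (hψ : ∀ P : geomTorsion W n, (ψ P : localPoints W E) = pointsMapOfEmb W ι P)
    (h : ∀ (x : Field.absoluteGaloisGroup E) (P : geomTorsion W n),
      ψ (resGalOfEmb ι x • P) = x • ψ P) :
    resKer (resGalOfEmb ι) ψ h = W.torsionLocalKer E n := by
  obtain ⟨τ, rfl⟩ := exists_algHom_eq_comp (closureEmb (K := K) E) ι
  -- the pair along `ι₀ ∘ τ` is the `τ`-conjugate of the pair along `ι₀ = closureEmb E`
  have hψ' : ψ = (torsionPointsMap W E n).comp
      (DistribSMul.toAddMonoidHom (geomTorsion W n) (show Field.absoluteGaloisGroup K from τ)) := by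
    ext P
    rw [hψ P, pointsMapOfEmb_comp, AddMonoidHom.comp_apply, AddMonoidHom.comp_apply,
      coe_torsionPointsMap, DistribSMul.toAddMonoidHom_apply, DistribSMul.toAddMonoidHom_apply,
      AddSubgroup.torsionBy.coe_smul]
    rfl
  change _ = resKer (resGal (K := K) E) (torsionPointsMap W E n) (torsionPointsMap_smul W E n)
  rw [resKer_congr (resGalOfEmb_comp (closureEmb (K := K) E) τ) hψ']
  exact resKer_conj_comp _ _ (torsionPointsMap_smul W E n) _ _

end Emb

/-! ## Strict local kernels grow along a tower `K → E → E'` -/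

section Tower

variable {K : Type u} [Field K] (W : WeierstrassCurve K)
variable {E : Type u} [Field E] [Algebra K E]
variable {E' : Type u} [Field E'] [Algebra K E'] [Algebra E E'] [IsScalarTower K E E']

/-- **Strict local kernels grow along a tower.** For `K`-fields `E → E'` (compatibly with `K`)
and `n : ℤ`, a class of `H¹(K, E[n])` that dies in `H¹(E, E(K̄_E)[n])` dies in
`H¹(E', E(K̄_{E'})[n])`: the restriction to `Γ_{E'}` factors through the restriction to `Γ_E`
(`resGalOfEmb_comp_tower`, functoriality `resH1Hom_resH1Hom`, the map on `n`-torsion points along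
`Ē → Ē'` being `pointsMapTower`), and the kernel at `E'` does not depend on the embedding used
(`torsionLocalKer_eq_resKer_of_emb`). The strict twin of `localRestrictionKer_le_of_tower`; applied
with `E = K_v`, `E' = L_w` for a place `w ∣ v`. [cite: SerreGaloisCohomology1997, I.§2.4 and II.§1.1]
[cite: MilneADT2006, I.§6] -/
theorem torsionLocalKer_le_of_tower (n : ℤ) : W.torsionLocalKer E n ≤ W.torsionLocalKer E' n := by
  intro c hc
  let ι₁ : AlgebraicClosure K →ₐ[K] AlgebraicClosure E := closureEmb (K := K) E
  let ι₂ : AlgebraicClosure E →ₐ[E] AlgebraicClosure E' := closureEmb (K := E) E'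
  -- the map on `n`-torsion points along `ι₂` (restriction of `pointsMapTower W ι₂`)
  let ψ₂ : AddSubgroup.torsionBy (localPoints W E) n →+ AddSubgroup.torsionBy (localPoints W E') n :=
    ((pointsMapTower W ι₂).comp (AddSubgroup.torsionBy (localPoints W E) n).subtype).codRestrict _
      fun Q ↦ by
        rw [mem_torsionBy_iff, AddMonoidHom.coe_comp, AddSubgroup.coe_subtype, Function.comp_apply,
          ← map_zsmul, mem_torsionBy_iff.mp Q.2, map_zero]
  have hψ₂ : ∀ (x : Field.absoluteGaloisGroup E') (Q : AddSubgroup.torsionBy (localPoints W E) n),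
      ψ₂ (resGalOfEmb (K := E) ι₂ x • Q) = x • ψ₂ Q := fun x Q ↦
    Subtype.ext (pointsMapTower_smul W ι₂ x (Q : localPoints W E))
  -- the composite pair `Γ_{E'} → Γ_E → Γ_K` is the pair along `ι₂ ∘ ι₁`
  let ψ : geomTorsion W n →+ AddSubgroup.torsionBy (localPoints W E') n :=
    ψ₂.comp (torsionPointsMap W E n)
  have hψval : ∀ P : geomTorsion W n,
      (ψ P : localPoints W E') = pointsMapOfEmb W ((ι₂.restrictScalars K).comp ι₁) P := by
    intro P
    rw [pointsMapOfEmb_comp_tower]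
    rfl
  have hcomp : ∀ (x : Field.absoluteGaloisGroup E') (P : geomTorsion W n),
      ψ (resGalOfEmb ((ι₂.restrictScalars K).comp ι₁) x • P) = x • ψ P := by
    intro x P
    rw [resGalOfEmb_comp_tower]
    change ψ₂ (torsionPointsMap W E n (resGal (K := K) E (resGalOfEmb (K := E) ι₂ x) • P)) = _
    rw [torsionPointsMap_smul, hψ₂]
    rfl
  rw [← torsionLocalKer_eq_resKer_of_emb W ((ι₂.restrictScalars K).comp ι₁) n ψ hψval hcomp,
    resKer_eq_ker, AddMonoidHom.mem_ker]
  have e : resH1Hom (resGalOfEmb ((ι₂.restrictScalars K).comp ι₁)) ψ hcomp =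
      resH1Hom ((resGal (K := K) E).comp (resGalOfEmb (K := E) ι₂)) (ψ₂.comp (torsionPointsMap W E n))
        (fun x m ↦ by
          change ψ₂ (torsionPointsMap W E n (resGal (K := K) E (resGalOfEmb (K := E) ι₂ x) • m)) =
            x • ψ₂ (torsionPointsMap W E n m)
          rw [torsionPointsMap_smul, hψ₂]) :=
    resH1Hom_congr (resGalOfEmb_comp_tower ι₁ ι₂) rfl _ _
  rw [e, ← resH1Hom_resH1Hom (resGal (K := K) E) (torsionPointsMap W E n) (torsionPointsMap_smul W E n)
    (resGalOfEmb (K := E) ι₂) ψ₂ hψ₂]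
  have h0 : resH1Hom (resGal (K := K) E) (torsionPointsMap W E n) (torsionPointsMap_smul W E n) c = 0 :=
    hc
  rw [h0, map_zero]

end Tower

/-! ## Strict local conditions under restriction to `L` -/

section BaseChange

variable {K : Type u} [Field K] (W : WeierstrassCurve K) {L : Type u} [Field L] [Algebra K L]
variable {E' : Type u} [Field E'] [Algebra K E'] [Algebra L E'] [IsScalarTower K L E']

/-- **Strict local conditions correspond under restriction to `L`.** For an `L`-field `E'`
(a completion `L_w`) and `ξ ∈ H¹(K, E[n])`: `ξ` dies in `H¹(E', E(K̄_{E'})[n])` iff its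
restriction `res ξ ∈ H¹(L, E_L[n])` (`resTorsion`) dies in `H¹(E', E_L(L̄_{E'})[n])`. Both are the
vanishing of `ξ` under the pair along `Γ_{E'} → Γ_L → Γ_K` (`resGalOfEmb_comp_tower`,
`resH1Hom_resH1Hom`, independence of the embedding `torsionLocalKer_eq_resKer_of_emb`), up to the
identification of coefficients `E(K̄_{E'})[n] = E_L(L̄_{E'})[n]` (`pointsCongr`,
`mem_resKer_iff_h1Equiv_mem`). The strict twin of `mem_localRestrictionKer_iff_resBaseChange_mem`.
[cite: SerreGaloisCohomology1997, I.§2.4 and II.§1.1] [cite: MilneADT2006, I.§6] -/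
theorem mem_torsionLocalKer_iff_resTorsion_mem (n : ℤ) (ξ : galH1Torsion W n) :
    ξ ∈ W.torsionLocalKer E' n ↔
      resTorsion W L n ξ ∈ (W.baseChange L).torsionLocalKer E' n := by
  let ιL : AlgebraicClosure K →ₐ[K] AlgebraicClosure L := closureEmb (K := K) L
  let ι₃ : AlgebraicClosure L →ₐ[L] AlgebraicClosure E' := closureEmb (K := L) E'
  -- the coefficient identification `E(K̄_{E'})[n] ≃ E_L(L̄_{E'})[n]` (restriction of `pointsCongr`)
  let θ₀ : localPoints W E' ≃+ localPoints (W.baseChange L) E' := pointsCongr W L (AlgebraicClosure E')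
  have hθ₀ : ∀ (x : Field.absoluteGaloisGroup E') (Q : localPoints W E'), θ₀ (x • Q) = x • θ₀ Q := by
    intro x Q
    rw [localPoints.smul_def, localPoints.smul_def]
    exact pointsCongr_map W L
      ((AlgEquiv.restrictScalars L
        (show AlgebraicClosure E' ≃ₐ[E'] AlgebraicClosure E' from x)) :
          AlgebraicClosure E' →ₐ[L] AlgebraicClosure E') Q
  have hmemθ : ∀ Q : localPoints W E', Q ∈ AddSubgroup.torsionBy (localPoints W E') n →
      θ₀ Q ∈ AddSubgroup.torsionBy (localPoints (W.baseChange L) E') n := by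
    intro Q hQ
    rw [mem_torsionBy_iff] at hQ ⊢
    rw [← map_zsmul, hQ, map_zero]
  let θfun : AddSubgroup.torsionBy (localPoints W E') n →+
      AddSubgroup.torsionBy (localPoints (W.baseChange L) E') n :=
    ((θ₀ : localPoints W E' →+ _).comp (AddSubgroup.torsionBy (localPoints W E') n).subtype).codRestrict
      _ fun Q ↦ hmemθ Q Q.2
  have hθbij : Function.Bijective θfun := by
    refine ⟨fun Q Q' hQQ' ↦ Subtype.ext (θ₀.injective (congrArg Subtype.val hQQ')), fun R ↦ ?_⟩
    refine ⟨⟨θ₀.symm R, ?_⟩, Subtype.ext (θ₀.apply_symm_apply R)⟩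
    have hR := R.2
    rw [mem_torsionBy_iff] at hR ⊢
    rw [← map_zsmul, hR, map_zero]
  let θN : AddSubgroup.torsionBy (localPoints W E') n ≃+
      AddSubgroup.torsionBy (localPoints (W.baseChange L) E') n := AddEquiv.ofBijective θfun hθbij
  have hθN : ∀ (x : Field.absoluteGaloisGroup E') (Q : AddSubgroup.torsionBy (localPoints W E') n),
      θN (x • Q) = x • θN Q := fun x Q ↦ Subtype.ext (hθ₀ x (Q : localPoints W E'))
  -- the pair along `ι₃ ∘ ιL` with target `E(K̄_{E'})[n]` computes `torsionLocalKer W E' n`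
  let ψ : geomTorsion W n →+ AddSubgroup.torsionBy (localPoints W E') n :=
    ((pointsMapOfEmb W ((ι₃.restrictScalars K).comp ιL)).comp (geomTorsion W n).subtype).codRestrict _
      fun P ↦ by
        rw [mem_torsionBy_iff, AddMonoidHom.coe_comp, AddSubgroup.coe_subtype, Function.comp_apply,
          ← map_zsmul, (mem_geomTorsion_iff W n _).mp P.2, map_zero]
  have hψval : ∀ P : geomTorsion W n,
      (ψ P : localPoints W E') = pointsMapOfEmb W ((ι₃.restrictScalars K).comp ιL) P := fun _ ↦ rfl
  have hψ : ∀ (x : Field.absoluteGaloisGroup E') (P : geomTorsion W n),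
      ψ (resGalOfEmb ((ι₃.restrictScalars K).comp ιL) x • P) = x • ψ P := fun x P ↦
    Subtype.ext (pointsMapOfEmb_smul W _ x (P : geomPoints W))
  rw [← torsionLocalKer_eq_resKer_of_emb W ((ι₃.restrictScalars K).comp ιL) n ψ hψval hψ]
  -- the pair defining `res ξ ∈ torsionLocalKer (W⁄L) E' n`, composed: same group map, coefficients
  -- intertwined by `θN`
  let ψ' : geomTorsion W n →+ AddSubgroup.torsionBy (localPoints (W.baseChange L) E') n :=
    (torsionPointsMap (W.baseChange L) E' n).comp (torsionBaseChangeMap W L n)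
  have hψ' : ∀ (x : Field.absoluteGaloisGroup E') (P : geomTorsion W n),
      ψ' (resGalOfEmb ((ι₃.restrictScalars K).comp ιL) x • P) = x • ψ' P := by
    intro x P
    rw [resGalOfEmb_comp_tower]
    change torsionPointsMap (W.baseChange L) E' n (torsionBaseChangeMap W L n
      (resGal (K := K) L (resGal (K := L) E' x) • P)) = _
    rw [torsionBaseChangeMap_smul, torsionPointsMap_smul]
    rfl
  have hsq : ∀ P : geomTorsion W n, ψ' ((AddEquiv.refl (geomTorsion W n)) P) = θN (ψ P) := by
    intro P
    apply Subtype.ext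
    change pointsMap (W.baseChange L) E' (localPointsEquivGeomPoints W L (pointsMap W L P)) =
      θ₀ (pointsMapOfEmb W ((ι₃.restrictScalars K).comp ιL) P)
    rw [pointsMapOfEmb_comp_tower, AddMonoidHom.comp_apply]
    exact (pointsCongr_map W L ι₃ (pointsMapOfEmb W ιL (P : geomPoints W))).symm
  rw [mem_resKer_iff_h1Equiv_mem (resGalOfEmb ((ι₃.restrictScalars K).comp ιL)) ψ hψ ψ' hψ'
    (AddEquiv.refl _) (fun _ _ ↦ rfl) θN hθN hsq ξ]
  -- `h1Equiv (refl) = id` and the right-hand pair is `resTorsion` followed by the local map at `E'`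
  have hid : h1Equiv (AddEquiv.refl (geomTorsion W n)) (fun _ _ ↦ rfl) ξ = ξ := by
    rw [h1Equiv_apply]
    have e : resH1Hom (ContinuousMonoidHom.id (Field.absoluteGaloisGroup K))
        ((AddEquiv.refl (geomTorsion W n)) : geomTorsion W n →+ geomTorsion W n) (fun _ _ ↦ rfl) =
          resH1Hom (ContinuousMonoidHom.id _) (AddMonoidHom.id _) (fun _ _ ↦ rfl) :=
      resH1Hom_congr rfl (by ext; rfl) _ _
    rw [e, resH1Hom_id]
    rfl
  rw [hid, resKer_eq_ker, AddMonoidHom.mem_ker]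
  have e : resH1Hom (resGalOfEmb ((ι₃.restrictScalars K).comp ιL)) ψ' hψ' =
      resH1Hom ((resGal (K := K) L).comp (resGal (K := L) E'))
        ((torsionPointsMap (W.baseChange L) E' n).comp (torsionBaseChangeMap W L n))
        (fun x m ↦ by
          change torsionPointsMap (W.baseChange L) E' n (torsionBaseChangeMap W L n
            (resGal (K := K) L (resGal (K := L) E' x) • m)) =
              x • torsionPointsMap (W.baseChange L) E' n (torsionBaseChangeMap W L n m)
          rw [torsionBaseChangeMap_smul, torsionPointsMap_smul]) :=
    resH1Hom_congr (resGalOfEmb_comp_tower ιL ι₃) rfl _ _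
  rw [e, ← resH1Hom_resH1Hom (resGal (K := K) L) (torsionBaseChangeMap W L n)
    (torsionBaseChangeMap_smul W L n) (resGal (K := L) E') (torsionPointsMap (W.baseChange L) E' n)
    (torsionPointsMap_smul (W.baseChange L) E' n)]
  rfl

end BaseChange

/-! ## Number fields: the binder (tower) of the over-`ℚ` descent at `p = 2` -/

section NumberField

open NumberField IsDedekindDomain

variable {K : Type u} [Field K] [NumberField K] (W : WeierstrassCurve K)
variable (L : Type u) [Field L] [NumberField L] [Algebra K L] (n : ℤ)

/-- **(tower) Strict local vanishing passes from `K_v` to `L_w` under restriction.** For number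
fields `K ⊆ L`, a finite place `w` of `L` over `v = w.under (𝓞 K)` and `ξ ∈ H¹(K, E[n])`: if
`ξ ↦ 0` in `H¹(K_v, E(K̄_v)[n])` then `res ξ ↦ 0` in `H¹(L_w, E_L(L̄_w)[n])`. With the completion
tower `K → K_v → L_w` (`adicCompletionMap`, as in `resBaseChange_mem_sha`): `ξ` dies at the
`K`-field `L_w` (`torsionLocalKer_le_of_tower`), which is the strict local condition of `res ξ` at
`w` (`mem_torsionLocalKer_iff_resTorsion_mem`). This is the plumbing binder `htower` of the
over-`ℚ` `2`-descent (`…CMKolyvaginAtInertTwoRationalDescentAtTwoDual`, `K = ℚ`).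
[cite: SerreGaloisCohomology1997, I.§2.4 and II.§1.1] [cite: McCallumLMS1991, §3 (3)]
[cite: MilneADT2006, I.§6] -/
theorem resTorsion_mem_torsionLocalKer_of_under (w : HeightOneSpectrum (𝓞 L)) {ξ : galH1Torsion W n}
    (hξ : ξ ∈ W.torsionLocalKer ((w.under (𝓞 K)).adicCompletion K) n) :
    resTorsion W L n ξ ∈ (W.baseChange L).torsionLocalKer (w.adicCompletion L) n := by
  let v : HeightOneSpectrum (𝓞 K) := w.under (𝓞 K)
  haveI : w.asIdeal.LiesOver v.asIdeal := ⟨rfl⟩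
  letI : Algebra (v.adicCompletion K) (w.adicCompletion L) :=
    (adicCompletionMap (K := K) L v w).toAlgebra
  haveI : IsScalarTower K (v.adicCompletion K) (w.adicCompletion L) :=
    IsScalarTower.of_algebraMap_eq fun x ↦ (adicCompletionMap_coe (K := K) L v w x).symm
  exact (mem_torsionLocalKer_iff_resTorsion_mem W n ξ).mp
    (torsionLocalKer_le_of_tower W (E := v.adicCompletion K) n hξ)

end NumberField

end Literature.NumberTheory.EllipticCurves

end
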